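import Summits.AnomalousDissipation.AnomalousDissipation.Theses.StirringSphere
import Summits.AnomalousDissipation.AnomalousDissipation.Theses.Ensemble
import Summits.AnomalousDissipation.AnomalousDissipation.Theorems.ResolvedDissipation.Negative.LoadBearing
import Summits.AnomalousDissipation.AnomalousDissipation.Theorems.MirrorVarietySteadyWeakIsGlobalLerayHopf
import Literature.Analysis.FluidPDE.DoeringFoiasProofs
import Literature.Analysis.FluidPDE.DoeringFoiasPowerProofs
import Literature.Analysis.FluidPDE.StatisticalSolutionDirac
import Literature.Analysis.FluidPDE.CylindricalGenerator
import Literature.Analysis.FluidPDE.SteadyNavierStokesEnergy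
import Literature.Analysis.FluidPDE.SteadyNavierStokesProofs
import Literature.Analysis.FluidPDE.StatisticalSolutionProofs
import Literature.Analysis.FunctionSpaces.TorusSobolevSpaceProofs

/-!
# Disproof of `EnsembleRealization` — work file (crux stmt-AnomalousDissipation-0215; routes StirringSphere rank 5 /
# Ensemble rank 3, the two route decls are the same term) — findings of the refuter crux-attack
# (refuter-rattack-stmt-AnomalousDissipation-0215-0, cycle 1, 2026-08-17): NO KILL; negative knowledge below.
# EXTENDED by the crux disprover (refuter-cdisprove-stmt-AnomalousDissipation-0215-0, cycle 1, 2026-08-17 12:30Z):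
# §7 `-- Targets` for the PICKED line `augmented-lift` (skeleton 097ec767): stub A (`stub_cylEnergyIneq`) holds on
# every steady atom and finite mixture of steady atoms (`cei_dirac_steady`, `cei_mixture_steady`) — CEI has no
# finite-dimensional test; §7b every Dirac FP law is a steady atom; §7c CEI holds for every FP measure carried by steady
# states (a counterexample must charge non-steady states); stubs B, C, D pass the misstatement audit; no target broken.
# Certified copies: p159273 `Negative/CylEnergyIneqAtoms.lean` (ACCEPTED), `Negative/CylEnergyIneqSteadyCarried.lean` (§7c,
# rev 2 p160420 adds §7c). §8: Dirac FP laws CHARACTERISED (steady weak ∧ V, via Temam's energy equation) and the crux is TRUE on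
# every Dirac FP law with M = E, no ½-loss, no extra hypothesis (`ensembleRealization_dirac`). Still NO KILL of the crux.

Certified copy proposed to the tree as `Theorems/EnsembleRealization/Negative/LoadBearing.lean` (p150971,
namespace `…Theorems.EnsembleRealization.Negative`); this work file carries the same theorems under the Cruxes
namespace so that ideators / triagers / the lead can read and `lean check` them before the proposal lands. A later
cdisprove seat EXTENDS this file (add `-- Targets` for the picked line's stuck stubs; do not restart it).

THE CRUX: `∀ f` smooth solenoidal mean-zero, `∀ E ε`, `0 < ε → ∃ M, ∀ ν μ, 0 < ν →` Foias–Prodi-stationary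
`μ` at `(ν, f)` `→ Integrable ‖u‖² μ → ∫|u|² dμ ≤ E → ε ≤ ν∫‖∇u‖² dμ → ∃ u₀ u,` global Leray–Hopf at `(ν, f)`
with `meanEnergy u ≤ M ∧ ε/2 ≤ meanDissipation ν u`. The conclusion does not mention `μ`: only the two numbers
are shadowed, by ONE trajectory.

## Findings
* NOT trivial (simp/aesop/norm_num/positivity/exact?/decide fail), NOT vacuous (`exists_admissible`), vacuous
  exactly beyond the Doering–Foias line `ε > ‖f‖₂√E` (`budget_of_admissible`, `ensembleRealization_vacuous_regime`).
* SMALL MODELS REALISED: Dirac laws at steady states in `V` (energy equation) are Foias–Prodi stationary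
  (`isStationaryStatisticalSolution_dirac_shearState`) and realised by their constant Leray–Hopf path with `M = E`
  and no `1/2`-loss (`realised_of_dirac_steady`, `laminar_realised`). A kill needs a DIFFUSE non-Vishik–Fursikov
  Foias–Prodi measure — none constructible in print or tree (convex-integration frontier, `L²_tH¹` non-Leray class).
* DECORATIONS: `0 < ν` (`ensembleRealization_iff_without_nu_pos`) and `Integrable ‖u‖² μ`
  (`ensembleRealization_iff_without_integrable`, from (1.29) + Poincaré) can be deleted without changing the crux.
* LOAD-BEARING: the dissipation floor (`ensembleRealization_false_without_loud`: `f = 0`, `δ₀`, Doering–Foias).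
  The energy ceiling `≤ E`: load-bearingness NOT decided (would need control of all bounded-energy Leray–Hopf
  solutions of Kolmogorov flow) — open question for ideators.
* REFUTED STRENGTHENING: `∃ M ∀ E ε` (`not_ensembleRealization_uniformM`); tightness `laminar_energy_floor`:
  any admissible `M(f,E,ε)` has `ε/2 ≤ ‖f‖₂ √(max M 0)` (consistent with the line's `M = 16‖f‖₁²E²/ε² + 1`).
* NOT attackable with atoms: the `1/2`-loss, `M` independent of `ε` at fixed `(f, E)`, `M = E`.
* `-- Targets` (§7, cdisprove cycle 1): line `augmented-lift` PICKED 11:35Z; stubs A `stub_cylEnergyIneq` (open),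
  B `stub_augmentedLift`, C `stub_marginalMeans`, D `stub_pathwiseCoupling`. A holds on all steady atoms / their finite
  mixtures (LHS ≤ 0 = RHS); B, C, D audited TRUE-as-stated on atoms and for junk (details in §7); 0 targets broken.
-/
noncomputable section

-- `Summit.<Summit>.<Problem>` is the tree's mandated summit-side namespace (CONVENTIONS §2); for this
-- single-conjunct summit the two segments coincide, so the duplicate is deliberate.
set_option linter.dupNamespace false

namespace Summit.AnomalousDissipation.AnomalousDissipation.Cruxes.EnsembleRealization.Disproof

open MeasureTheory Filter Topology
open scoped ENNReal InnerProductSpace RealInnerProductSpace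
open Literature.Analysis.FunctionSpaces Literature.Analysis.FluidPDE
open Summit.AnomalousDissipation.AnomalousDissipation.Theses.StirringSphere (EnsembleRealization)
open Summit.AnomalousDissipation.AnomalousDissipation.Theorems.ResolvedDissipation.Negative

/-! ## §0 The two route copies coincide -/

/-- The StirringSphere and Ensemble copies of the crux are the same proposition. [folklore] -/
theorem ensembleRealization_iff_ensemble :
    EnsembleRealization ↔ Summit.AnomalousDissipation.AnomalousDissipation.Theses.Ensemble.EnsembleRealization :=
  Iff.rfl

/-! ## §1 The laminar witness family: Dirac laws at shear states are Foias–Prodi stationary -/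

/-- `((K_{M,a}), K_{M,c a}) = c a²/2`. [folklore] -/
theorem pairing_shearState_shearField {M : ℕ} (hM : M ≠ 0) (c a : ℝ) :
    Torus.pairing (shearState M hM a).1 (shearField M (c * a)) = c * (a ^ 2 / 2) := by
  unfold Torus.pairing
  have h : (fun x => ⟪((shearState M hM a).1 : T3 → R3) x, shearField M (c * a) x⟫_ℝ) =ᵐ[volume]
      fun x => c * ‖shearField M a x‖ ^ 2 := by
    filter_upwards [coe_shearState_ae hM a] with x hx
    rw [hx, shearField_mul, real_inner_smul_right, real_inner_self_eq_norm_sq]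
  rw [integral_congr_ae h, integral_const_mul, integral_norm_sq_shearField hM a]

/-- The energy EQUATION of the laminar state: `ν‖∇K_{M,a}‖² = (K_{M,a}, 4π²νM²K_{M,a}) = 2π²νM²a²`. [folklore] -/
theorem laminar_energy_eq {M : ℕ} (hM : M ≠ 0) (ν a : ℝ) :
    ν * (Torus.eGradNormSq ((shearState M hM a).1 : T3 → R3)).toReal =
      Torus.pairing (shearState M hM a).1 (shearField M (4 * Real.pi ^ 2 * ν * (M : ℝ) ^ 2 * a)) := by
  rw [eGradNormSq_shearState hM a, ENNReal.toReal_ofReal (by positivity), pairing_shearState_shearField hM]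
  ring

/-- `K_{M,a}` is a steady weak solution of NS_ν at force `4π²νM²K_{M,a}`. [folklore] -/
theorem isSteadyWeakSolution_shearState {M : ℕ} (hM : M ≠ 0) (ν a : ℝ) :
    Torus.IsSteadyWeakSolution ν (shearField M (4 * Real.pi ^ 2 * ν * (M : ℝ) ^ 2 * a)) (shearState M hM a) :=
  fun _w hw _ _ => nsGeneratorPairing_shearField (coe_shearState_ae hM a) hw

/-- `K_{M,a} ∈ V`. [folklore] -/
theorem shearState_mem_energySpaceV {M : ℕ} (hM : M ≠ 0) (a : ℝ) :
    (shearState M hM a).1 ∈ Torus.energySpaceV (Fin 3) :=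
  Torus.smoothSolenoidal_subset_energySpaceV_holds
    ⟨shearField M a, isSmooth_shearField M a, isDivFree_shearField M a, hasZeroMean_shearField hM a,
      coe_shearState_ae hM a⟩

/-- **The laminar Dirac is Foias–Prodi stationary**: `δ_{K_{M,a}}` is a stationary statistical solution
(FMRT IV Def. 1.3: (1.29)–(1.31)) of NS_ν forced by `4π²νM² K_{M,a}`, for EVERY `ν`. [folklore] -/
theorem isStationaryStatisticalSolution_dirac_shearState {M : ℕ} (hM : M ≠ 0) (ν a : ℝ) :
    Torus.IsStationaryStatisticalSolution ν (shearField M (4 * Real.pi ^ 2 * ν * (M : ℝ) ^ 2 * a))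
      (Measure.dirac (shearState M hM a)) :=
  (isSteadyWeakSolution_shearState hM ν a).isStationaryStatisticalSolution_dirac
    (shearState_mem_energySpaceV hM a) (laminar_energy_eq hM ν a).le

/-- Energy of a Dirac law: `∫|u|² dδ_U = ‖U‖²`. [folklore] -/
theorem ensembleEnergy_dirac (U : H3) : Torus.ensembleEnergy (Measure.dirac U) = ‖U‖ ^ 2 := by
  haveI : MeasurableSingletonClass H3 := OpensMeasurableSpace.toMeasurableSingletonClass
  unfold Torus.ensembleEnergy
  rw [integral_dirac]

/-- Dissipation of a Dirac law: `ν∫‖∇u‖² dδ_U = ν‖∇U‖²`. [folklore] -/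
theorem ensembleDissipation_dirac (ν : ℝ) (U : H3) :
    Torus.ensembleDissipation ν (Measure.dirac U) = ν * (Torus.eGradNormSq (U.1 : T3 → R3)).toReal := by
  haveI : MeasurableSingletonClass H3 := OpensMeasurableSpace.toMeasurableSingletonClass
  unfold Torus.ensembleDissipation Torus.ensembleEnstrophy
  rw [lintegral_dirac]

/-- **The laminar state realises itself**: the constant path at `K_{M,a}` is a global Leray–Hopf solution of
NS_ν forced by `4π²νM²K_{M,a}` with `meanEnergy = a²/2` and `meanDissipation = 2π²νM²a²` (landed
`steadyWeakIsGlobalLerayHopf_proof`). [folklore] -/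
theorem laminar_realised {M : ℕ} (hM : M ≠ 0) {ν : ℝ} (hν : 0 < ν) (a : ℝ) :
    Torus.IsGlobalLerayHopf ν (fun _ => shearField M (4 * Real.pi ^ 2 * ν * (M : ℝ) ^ 2 * a))
        ((shearState M hM a).1 : T3 → R3) (fun _ => ((shearState M hM a).1 : T3 → R3)) ∧
      meanEnergy (fun _ : ℝ => ((shearState M hM a).1 : T3 → R3)) = a ^ 2 / 2 ∧
      meanDissipation ν (fun _ : ℝ => ((shearState M hM a).1 : T3 → R3)) =
        ν * (2 * Real.pi ^ 2 * (M : ℝ) ^ 2 * a ^ 2) := by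
  obtain ⟨h1, h2, h3⟩ := Summit.AnomalousDissipation.AnomalousDissipation.Theorems.steadyWeakIsGlobalLerayHopf_proof ν _ (shearState M hM a) hν (isSmooth_shearField M _)
    (hasZeroMean_shearField hM _) (shearState_mem_energySpaceV hM a) (isSteadyWeakSolution_shearState hM ν a)
    (laminar_energy_eq hM ν a)
  refine ⟨h1, ?_, ?_⟩
  · rw [h2, Torus.integral_norm_sq_coe_eq]
    exact norm_sq_shearState hM a
  · rw [h3, eGradNormSq_shearState hM a, ENNReal.toReal_ofReal (by positivity)]

/-! ## §2 Small models: Dirac laws at steady states are realised with `M = E` and no loss -/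

/-- **On atoms the crux holds with room.** If `U ∈ V` is a steady weak solution with the energy equation, then
for every budget pair met by `δ_U` the constant path realises it with `meanEnergy ≤ E` and `meanDissipation ≥ ε`
(not only `ε/2`). [folklore] -/
theorem realised_of_dirac_steady {ν : ℝ} (hν : 0 < ν) {f : T3 → R3} (hf : Torus.IsSmooth f)
    (hf0 : Torus.HasZeroMean f) {U : H3} (hV : U.1 ∈ Torus.energySpaceV (Fin 3))
    (hU : Torus.IsSteadyWeakSolution ν f U)
    (heq : ν * (Torus.eGradNormSq (U.1 : T3 → R3)).toReal = Torus.pairing U.1 f)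
    {E ε : ℝ} (hE : Torus.ensembleEnergy (Measure.dirac U) ≤ E)
    (hε : ε ≤ Torus.ensembleDissipation ν (Measure.dirac U)) :
    ∃ (u₀ : T3 → R3) (u : ℝ → T3 → R3), Torus.IsGlobalLerayHopf ν (fun _ => f) u₀ u ∧
      meanEnergy u ≤ E ∧ ε ≤ meanDissipation ν u := by
  obtain ⟨h1, h2, h3⟩ := Summit.AnomalousDissipation.AnomalousDissipation.Theorems.steadyWeakIsGlobalLerayHopf_proof ν f U hν hf hf0 hV hU heq
  refine ⟨_, _, h1, ?_, ?_⟩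
  · rw [h2, Torus.integral_norm_sq_coe_eq]
    have hE' : ‖U‖ ^ 2 ≤ E := by rwa [ensembleEnergy_dirac] at hE
    exact hE'
  · rw [h3, ← ensembleDissipation_dirac]
    exact hε

/-! ## §3 Decorations: `0 < ν` and `Integrable ‖u‖² μ` are implied by the other hypotheses -/

/-- **DECORATION 1.** The clause `0 < ν` is implied by the floor: `ensembleDissipation ν μ = ν · toReal _ ≤ 0`
for `ν ≤ 0`. The crux with `0 < ν` DELETED is equivalent to the crux. [folklore] -/
theorem ensembleRealization_iff_without_nu_pos :
    EnsembleRealization ↔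
      ∀ f : UnitAddTorus (Fin 3) → EuclideanSpace ℝ (Fin 3), Literature.Analysis.FunctionSpaces.Torus.IsSmooth f → Literature.Analysis.FunctionSpaces.Torus.IsDivFree f → Literature.Analysis.FunctionSpaces.Torus.HasZeroMean f → ∀ (E ε : ℝ), 0 < ε → ∃ M : ℝ, ∀ (ν : ℝ) (μ : MeasureTheory.Measure (Literature.Analysis.FunctionSpaces.Torus.energySpace (Fin 3))), Literature.Analysis.FluidPDE.Torus.IsStationaryStatisticalSolution ν f μ → MeasureTheory.Integrable (fun u => ‖u‖ ^ 2) μ → Literature.Analysis.FluidPDE.Torus.ensembleEnergy μ ≤ E → ε ≤ Literature.Analysis.FluidPDE.Torus.ensembleDissipation ν μ → ∃ (u₀ : UnitAddTorus (Fin 3) → EuclideanSpace ℝ (Fin 3)) (u : ℝ → UnitAddTorus (Fin 3) → EuclideanSpace ℝ (Fin 3)), Literature.Analysis.FluidPDE.Torus.IsGlobalLerayHopf ν (fun _ => f) u₀ u ∧ Literature.Analysis.FluidPDE.meanEnergy u ≤ M ∧ ε / 2 ≤ Literature.Analysis.FluidPDE.meanDissipation ν u := by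
  refine ⟨fun h f hf hd hz E ε hε => ?_, fun h f hf hd hz E ε hε => ?_⟩
  · obtain ⟨M, hM⟩ := h f hf hd hz E ε hε
    refine ⟨M, fun ν μ hμ hi hE hεμ => hM ν μ ?_ hμ hi hE hεμ⟩
    by_contra hν
    have : Torus.ensembleDissipation ν μ ≤ 0 :=
      mul_nonpos_of_nonpos_of_nonneg (not_lt.1 hν) ENNReal.toReal_nonneg
    linarith
  · obtain ⟨M, hM⟩ := h f hf hd hz E ε hε
    exact ⟨M, fun ν μ _ hμ hi hE hεμ => hM ν μ hμ hi hE hεμ⟩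

/-- **Finite mean enstrophy gives finite mean energy**: a Foias–Prodi stationary statistical solution has
`∫ |u|² dμ < ∞` ((1.29) and the Poincaré inequality `|u|² ≤ ‖∇u‖²` on `H`, `Torus.enorm_sq_le_eGradNormSq`). [folklore] -/
theorem integrable_norm_sq_of_isStationaryStatisticalSolution {ν : ℝ} {f : T3 → R3} {μ : Measure H3}
    (hμ : Torus.IsStationaryStatisticalSolution ν f μ) : Integrable (fun u : H3 => ‖u‖ ^ 2) μ := by
  refine ⟨(continuous_norm.pow 2).aestronglyMeasurable, ?_⟩
  have hle : ∀ u : H3, ‖‖u‖ ^ 2‖ₑ ≤ Torus.eGradNormSq (u.1 : T3 → R3) := fun u => by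
    rw [Real.enorm_eq_ofReal (sq_nonneg _), ENNReal.ofReal_pow (norm_nonneg _), ofReal_norm]
    exact Torus.enorm_sq_le_eGradNormSq u
  exact lt_of_le_of_lt (lintegral_mono hle) hμ.enstrophy_finite

/-- **DECORATION 2.** The clause `Integrable (fun u => ‖u‖ ^ 2) μ` is implied by Foias–Prodi stationarity;
the crux with it DELETED is equivalent to the crux. [folklore] -/
theorem ensembleRealization_iff_without_integrable :
    EnsembleRealization ↔
      ∀ f : UnitAddTorus (Fin 3) → EuclideanSpace ℝ (Fin 3), Literature.Analysis.FunctionSpaces.Torus.IsSmooth f → Literature.Analysis.FunctionSpaces.Torus.IsDivFree f → Literature.Analysis.FunctionSpaces.Torus.HasZeroMean f → ∀ (E ε : ℝ), 0 < ε → ∃ M : ℝ, ∀ (ν : ℝ) (μ : MeasureTheory.Measure (Literature.Analysis.FunctionSpaces.Torus.energySpace (Fin 3))), 0 < ν → Literature.Analysis.FluidPDE.Torus.IsStationaryStatisticalSolution ν f μ → Literature.Analysis.FluidPDE.Torus.ensembleEnergy μ ≤ E → ε ≤ Literature.Analysis.FluidPDE.Torus.ensembleDissipation ν μ → ∃ (u₀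 : UnitAddTorus (Fin 3) → EuclideanSpace ℝ (Fin 3)) (u : ℝ → UnitAddTorus (Fin 3) → EuclideanSpace ℝ (Fin 3)), Literature.Analysis.FluidPDE.Torus.IsGlobalLerayHopf ν (fun _ => f) u₀ u ∧ Literature.Analysis.FluidPDE.meanEnergy u ≤ M ∧ ε / 2 ≤ Literature.Analysis.FluidPDE.meanDissipation ν u := by
  refine ⟨fun h f hf hd hz E ε hε => ?_, fun h f hf hd hz E ε hε => ?_⟩
  · obtain ⟨M, hM⟩ := h f hf hd hz E ε hε
    exact ⟨M, fun ν μ hν hμ hE hεμ => hM ν μ hν hμ (integrable_norm_sq_of_isStationaryStatisticalSolution hμ) hE hεμ⟩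
  · obtain ⟨M, hM⟩ := h f hf hd hz E ε hε
    exact ⟨M, fun ν μ hν hμ _ hE hεμ => hM ν μ hν hμ hE hεμ⟩

/-! ## §4 Load-bearing: the dissipation floor -/

/-- **The Doering–Foias budget of a global Leray–Hopf solution** (`ν > 0`, smooth mean-zero steady force):
`meanDissipation ν u ≤ ‖f‖₂ √(meanEnergy u)` (in tree: `DoeringFoias2002_dissipation_le_power_holds` and
`IsGlobalLerayHopf.meanPower_le`). [cite: CheskidovDoeringPetrov2006, eq. (11) and eq. (17)] -/
theorem lerayHopf_budget {ν : ℝ} (hν : 0 < ν) {f : T3 → R3} (hf : Torus.IsSmooth f)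
    (hf0 : Torus.HasZeroMean f) {u₀ : T3 → R3} {u : ℝ → T3 → R3}
    (hu : Torus.IsGlobalLerayHopf ν (fun _ => f) u₀ u) :
    meanDissipation ν u ≤ Real.sqrt (∫ x, ‖f x‖ ^ 2) * Real.sqrt (meanEnergy u) := by
  have h1 := DoeringFoias2002_dissipation_le_power_holds hν (hf.memLp 2) hf0 u₀ u hu
  have h2 := hu.meanPower_le hν hf hf0
  rw [rmsVelocity_eq_sqrt_meanEnergy] at h2
  exact h1.trans h2

/-- `δ₀` (the Dirac law at rest, `K_{1,0} = 0`) is Foias–Prodi stationary for the UNFORCED equations at every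
viscosity. [folklore] -/
theorem isStationaryStatisticalSolution_dirac_rest (ν : ℝ) :
    Torus.IsStationaryStatisticalSolution ν (0 : T3 → R3) (Measure.dirac (shearState 1 one_ne_zero 0)) := by
  have h := isStationaryStatisticalSolution_dirac_shearState one_ne_zero ν 0
  rwa [mul_zero, shearField_zero] at h

/-- **The dissipation floor is load-bearing.** With the clause `ε ≤ ensembleDissipation ν μ` DELETED the
statement is FALSE: at `f = 0` the law `δ₀` meets every remaining hypothesis (`ν = 1`, `E = 0`), while no
global Leray–Hopf solution of unforced NS dissipates `ε/2 = 1/2` in the mean (`meanDissipation ≤ ‖0‖₂√· = 0`).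
So any proof must USE the floor quantitatively (it is the only hypothesis distinguishing `μ` from `δ₀`).
(The refuted statement — WEAKENING 1 — `EnsembleRealization` without `ε ≤ ensembleDissipation ν μ`, all else
verbatim.) [folklore] -/
theorem ensembleRealization_false_without_loud :
    ¬ (∀ f : UnitAddTorus (Fin 3) → EuclideanSpace ℝ (Fin 3), Literature.Analysis.FunctionSpaces.Torus.IsSmooth f → Literature.Analysis.FunctionSpaces.Torus.IsDivFree f → Literature.Analysis.FunctionSpaces.Torus.HasZeroMean f → ∀ (E ε : ℝ), 0 < ε → ∃ M : ℝ, ∀ (ν : ℝ) (μ : MeasureTheory.Measure (Literature.Analysis.FunctionSpaces.Torus.energySpace (Fin 3))), 0 < ν → Literature.Analysis.FluidPDE.Torus.IsStationaryStatisticalSolution ν f μ → MeasureTheory.Integrable (fun u => ‖u‖ ^ 2) μ → Literature.Analysis.FluidPDE.Torus.ensembleEnergy μ ≤ E → ∃ (u₀ : UnitAddTorus (Fin 3) → EuclideanSpace ℝ (Fin 3)) (u : ℝ → UnitAddTorus (Fin 3) → EuclideanSpace ℝ (Fin 3)), Literature.Analysis.FluidPDE.Torus.IsGlobalLerayHopf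 ν (fun _ => f) u₀ u ∧ Literature.Analysis.FluidPDE.meanEnergy u ≤ M ∧ ε / 2 ≤ Literature.Analysis.FluidPDE.meanDissipation ν u) := by
  intro h
  obtain ⟨M, hM⟩ := h 0 isSmooth_zero isDivFree_zero hasZeroMean_zero 0 1 one_pos
  obtain ⟨u₀, u, hu, -, hε⟩ := hM 1 _ one_pos (isStationaryStatisticalSolution_dirac_rest 1)
    (Torus.integrable_dirac _ _) (le_of_eq (by rw [ensembleEnergy_dirac, norm_sq_shearState]; ring))
  have hb := lerayHopf_budget one_pos isSmooth_zero hasZeroMean_zero hu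
  simp at hb
  linarith

/-! ## §5 Refuted strengthening: `M` cannot precede the budgets; the realised-energy floor -/

/-- **THE REALISED-ENERGY FLOOR (tightness reading).** For the fixed force `K_{1,1}` and every `ν > 0` the
laminar law `δ_{K_{1,a}}`, `a = 1/(4π²ν)`, is admissible with `E = a²/2`, `ε = 2π²νa²`; hence ANY `M` for which
the crux's implication holds at these budgets satisfies `ε/2 = 1/(16π²ν) ≤ √(1/2)·√(max M 0)`, i.e.
`M ≥ ε²/(2‖f‖₂²)`: the realised energy ceiling cannot sit below the injection scale. [folklore] -/
theorem laminar_energy_floor {ν : ℝ} (hν : 0 < ν) {M : ℝ}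
    (h : ∀ μ : Measure H3,
      Torus.IsStationaryStatisticalSolution ν (shearField 1 1) μ → Integrable (fun u : H3 => ‖u‖ ^ 2) μ →
        Torus.ensembleEnergy μ ≤ (1 / (4 * Real.pi ^ 2 * ν)) ^ 2 / 2 →
          ν * (2 * Real.pi ^ 2 * ((1 : ℕ) : ℝ) ^ 2 * (1 / (4 * Real.pi ^ 2 * ν)) ^ 2) ≤ Torus.ensembleDissipation ν μ →
            ∃ (u₀ : T3 → R3) (u : ℝ → T3 → R3), Torus.IsGlobalLerayHopf ν (fun _ => shearField 1 1) u₀ u ∧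
              meanEnergy u ≤ M ∧ ν * (2 * Real.pi ^ 2 * ((1 : ℕ) : ℝ) ^ 2 * (1 / (4 * Real.pi ^ 2 * ν)) ^ 2) / 2 ≤
                meanDissipation ν u) :
    1 / (16 * Real.pi ^ 2 * ν) ≤ Real.sqrt (1 / 2) * Real.sqrt (max M 0) := by
  have hπ : 0 < Real.pi := Real.pi_pos
  have hν0 : ν ≠ 0 := hν.ne'
  set a : ℝ := 1 / (4 * Real.pi ^ 2 * ν) with ha
  have hfa : shearField 1 (4 * Real.pi ^ 2 * ν * ((1 : ℕ) : ℝ) ^ 2 * a) = shearField 1 1 := by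
    congr 1
    simp only [ha, Nat.cast_one, one_pow, mul_one]
    field_simp
  have hFP := isStationaryStatisticalSolution_dirac_shearState one_ne_zero ν a
  rw [hfa] at hFP
  obtain ⟨u₀, u, hu, hMe, hε⟩ := h _ hFP (Torus.integrable_dirac _ _)
    (le_of_eq (by rw [ensembleEnergy_dirac, norm_sq_shearState]))
    (ge_of_eq (by rw [ensembleDissipation_dirac, eGradNormSq_shearState, ENNReal.toReal_ofReal (by positivity)]))
  have hb := lerayHopf_budget hν (isSmooth_shearField 1 1) (hasZeroMean_shearField one_ne_zero 1) hu
  rw [integral_norm_sq_shearField one_ne_zero, one_pow] at hb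
  have hme : Real.sqrt (meanEnergy u) ≤ Real.sqrt (max M 0) := Real.sqrt_le_sqrt (hMe.trans (le_max_left _ _))
  have hdiss : meanDissipation ν u ≤ Real.sqrt (1 / 2) * Real.sqrt (max M 0) :=
    hb.trans (mul_le_mul_of_nonneg_left hme (Real.sqrt_nonneg _))
  have hval : ν * (2 * Real.pi ^ 2 * ((1 : ℕ) : ℝ) ^ 2 * a ^ 2) / 2 = 1 / (16 * Real.pi ^ 2 * ν) := by
    simp only [ha, Nat.cast_one, one_pow, mul_one]
    field_simp
    ring
  linarith

/-- **`M` CANNOT BE CHOSEN BEFORE THE BUDGETS** (`∃ M ∀ E ε` is FALSE; `M = M(f, E, ε)` genuinely depends on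
the budgets): fixed force `K_{1,1}`, laminar laws `δ_{K_{1,1/(4π²ν)}}` along `ν → 0` with budgets
`E(ν) = 1/(32π⁴ν²)`, `ε(ν) = 1/(8π²ν)`; the Doering–Foias budget caps every Leray–Hopf solution of energy `≤ M`
at dissipation `√(M/2)`, below `ε(ν)/2` once `ν < 1/(16π²(√(M/2)+1))`.
(The refuted statement — STRENGTHENING 1 — `EnsembleRealization` with `∃ M` moved before `∀ E ε`, all else
verbatim.) [folklore] -/
theorem not_ensembleRealization_uniformM :
    ¬ (∀ f : UnitAddTorus (Fin 3) → EuclideanSpace ℝ (Fin 3), Literature.Analysis.FunctionSpaces.Torus.IsSmooth f → Literature.Analysis.FunctionSpaces.Torus.IsDivFree f → Literature.Analysis.FunctionSpaces.Torus.HasZeroMean f → ∃ M : ℝ, ∀ (E ε : ℝ), 0 < ε → ∀ (ν : ℝ) (μ : MeasureTheory.Measure (Literature.Analysis.FunctionSpaces.Torus.energySpace (Fin 3))), 0 < ν → Literature.Analysis.FluidPDE.Torus.IsStationaryStatisticalSolution ν f μ → MeasureTheory.Integrable (fun u => ‖u‖ ^ 2) μ → Literature.Analysis.FluidPDE.Torus.ensembleEnergy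 μ ≤ E → ε ≤ Literature.Analysis.FluidPDE.Torus.ensembleDissipation ν μ → ∃ (u₀ : UnitAddTorus (Fin 3) → EuclideanSpace ℝ (Fin 3)) (u : ℝ → UnitAddTorus (Fin 3) → EuclideanSpace ℝ (Fin 3)), Literature.Analysis.FluidPDE.Torus.IsGlobalLerayHopf ν (fun _ => f) u₀ u ∧ Literature.Analysis.FluidPDE.meanEnergy u ≤ M ∧ ε / 2 ≤ Literature.Analysis.FluidPDE.meanDissipation ν u) := by
  intro h
  obtain ⟨M, hM⟩ := h (shearField 1 1) (isSmooth_shearField 1 1) (isDivFree_shearField 1 1)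
    (hasZeroMean_shearField one_ne_zero 1)
  set S : ℝ := Real.sqrt (1 / 2) * Real.sqrt (max M 0) with hS
  have hS0 : 0 ≤ S := mul_nonneg (Real.sqrt_nonneg _) (Real.sqrt_nonneg _)
  have hS1 : 0 < S + 1 := by linarith
  set ν : ℝ := 1 / (16 * Real.pi ^ 2 * (S + 1)) with hν
  have hπ : 0 < Real.pi := Real.pi_pos
  have hνpos : 0 < ν := by positivity
  have hεpos : 0 < ν * (2 * Real.pi ^ 2 * ((1 : ℕ) : ℝ) ^ 2 * (1 / (4 * Real.pi ^ 2 * ν)) ^ 2) := by positivity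
  have hfloor := laminar_energy_floor hνpos (M := M) fun μ hμ hi hE hεμ => hM _ _ hεpos ν μ hνpos hμ hi hE hεμ
  have hval : 1 / (16 * Real.pi ^ 2 * ν) = S + 1 := by
    rw [hν]
    field_simp
  rw [hval] at hfloor
  linarith

/-! ## §6 The vacuity regime: admissible budgets obey `ε ≤ ‖f‖₂ √E` -/

/-- **Budget of an admissible law**: Foias–Prodi stationarity with `∫|u|² dμ ≤ E` and `ν∫‖∇u‖² dμ ≥ ε` forces
`ε ≤ ‖f‖₂ √E` (in tree: `ensembleDissipation_le_of_isStationary_holds`). [folklore] -/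
theorem budget_of_admissible {ν : ℝ} {f : T3 → R3} (hf : Torus.IsSmooth f) {μ : Measure H3}
    (hμ : Torus.IsStationaryStatisticalSolution ν f μ) (hi : Integrable (fun u : H3 => ‖u‖ ^ 2) μ) {E ε : ℝ}
    (hE : Torus.ensembleEnergy μ ≤ E) (hε : ε ≤ Torus.ensembleDissipation ν μ) :
    ε ≤ Real.sqrt (∫ x, ‖f x‖ ^ 2) * Real.sqrt E :=
  hε.trans ((Torus.ensembleDissipation_le_of_isStationary_holds hμ (hf.memLp 2) hi).trans
    (mul_le_mul_of_nonneg_left (Real.sqrt_le_sqrt hE) (Real.sqrt_nonneg _)))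

/-- **VACUITY REGIME.** For budgets beyond the Doering–Foias line, `‖f‖₂ √E < ε`, no Foias–Prodi law meets the
hypotheses, so the crux's implication holds there for EVERY `M` (the content of the crux lives in
`0 < ε ≤ ‖f‖₂ √E`). [folklore] -/
theorem ensembleRealization_vacuous_regime (f : T3 → R3) (hf : Torus.IsSmooth f) (E ε M : ℝ)
    (hgap : Real.sqrt (∫ x, ‖f x‖ ^ 2) * Real.sqrt E < ε) :
    ∀ (ν : ℝ) (μ : Measure H3), 0 < ν → Torus.IsStationaryStatisticalSolution ν f μ →
      Integrable (fun u : H3 => ‖u‖ ^ 2) μ → Torus.ensembleEnergy μ ≤ E → ε ≤ Torus.ensembleDissipation ν μ →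
        ∃ (u₀ : T3 → R3) (u : ℝ → T3 → R3), Torus.IsGlobalLerayHopf ν (fun _ => f) u₀ u ∧
          meanEnergy u ≤ M ∧ ε / 2 ≤ meanDissipation ν u :=
  fun _ν _μ _ hμ hi hE hε => absurd (budget_of_admissible hf hμ hi hE hε) (not_le.2 hgap)

/-- **NON-VACUITY inside the line.** The hypotheses of the crux ARE met (so the crux is not vacuously true):
for every `ν > 0` the laminar law of `K_{1,1}` is admissible at `E = a²/2`, `ε = 2π²νa²`, `a = 1/(4π²ν)`. [folklore] -/
theorem exists_admissible {ν : ℝ} (hν : 0 < ν) :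
    ∃ (μ : Measure H3) (E ε : ℝ), 0 < ε ∧ Torus.IsStationaryStatisticalSolution ν (shearField 1 1) μ ∧
      Integrable (fun u : H3 => ‖u‖ ^ 2) μ ∧ Torus.ensembleEnergy μ ≤ E ∧ ε ≤ Torus.ensembleDissipation ν μ := by
  have hπ : 0 < Real.pi := Real.pi_pos
  have hν0 : ν ≠ 0 := hν.ne'
  set a : ℝ := 1 / (4 * Real.pi ^ 2 * ν) with ha
  have ha0 : 0 < a := by positivity
  have hfa : shearField 1 (4 * Real.pi ^ 2 * ν * ((1 : ℕ) : ℝ) ^ 2 * a) = shearField 1 1 := by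
    congr 1
    simp only [ha, Nat.cast_one, one_pow, mul_one]
    field_simp
  have hFP := isStationaryStatisticalSolution_dirac_shearState one_ne_zero ν a
  rw [hfa] at hFP
  refine ⟨_, a ^ 2 / 2, ν * (2 * Real.pi ^ 2 * ((1 : ℕ) : ℝ) ^ 2 * a ^ 2), by positivity, hFP,
    Torus.integrable_dirac _ _, le_of_eq (by rw [ensembleEnergy_dirac, norm_sq_shearState]),
    ge_of_eq (by rw [ensembleDissipation_dirac, eGradNormSq_shearState, ENNReal.toReal_ofReal (by positivity)])⟩


/-! ## §7 Line `augmented-lift` (PICKED 2026-08-17T11:35Z, skeleton 097ec767) — `-- Targets`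

The lead's registered stubs: `stub_cylEnergyIneq` (A, OPEN: FP ⇒ CEI), `stub_augmentedLift` (B, XL),
`stub_marginalMeans` (C), `stub_pathwiseCoupling` (D). Findings of the disprover (cdisprove cycle 1, this seat):

* **A on atoms.** `CEI ν f μ` below is VERBATIM the conclusion of `stub_cylEnergyIneq` (= hypothesis `hcei` of
  `stub_augmentedLift`). It HOLDS — with room, `LHS ≤ 0 = RHS` — on every Dirac law `δ_U` at a steady weak solution
  with the steady energy inequality `ν‖U‖_V² ≤ (f,U)` (`cei_dirac_steady`), and on every finite mixture of such atoms
  (`cei_mixture_steady`), for EVERY `ν` (no sign needed) and without Foias–Prodi stationarity of the mixture being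
  used: the right-hand side vanishes by linearity of the tested generator in the test field
  (`Torus.nsGeneratorPairing_sum_smul`) and steadiness, the left-hand side is `2 ∂ₑψ · (ν‖U‖_V² − (f,U)) ≤ 0` because
  `∂ₑψ ≥ 0` for a profile nondecreasing in `e` (`fderiv_inr_nonneg_of_monotone`). Since a finitely supported
  Foias–Prodi measure is a mixture of steady atoms (Liouville identity tested on a cylindrical functional whose
  profile separates the atoms — recorded, not formalised here), CEI HAS NO FINITE-DIMENSIONAL / EXPLICIT TEST: a
  counterexample to stub A must be a DIFFUSE non-Vishik–Fursikov Foias–Prodi measure with conditional mean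
  backscatter `lim_K ∫ a(ξ(u)) b(u,u,P_K u) dμ < 0` for some cylindrical weight `a ≥ 0` — the same unconstructible
  object a kill of the crux itself needs. Stub A is therefore NOT attackable by this seat beyond atoms; it is also not
  derivable from FP by the Galerkin device `ψ(ξ(u), |P_K u|²)` without a domination of the flux
  `|b(u,u,Q_K u)| ≲ |u|^{1/2}‖u‖_V^{5/2}` (exactly the `onsager-moment` 5/4-moment; with it one gets EQUALITY in CEI).
* **B, C, D misstatement audit: PASS.** On atoms B is witnessed by the Dirac law at the constant coefficient path
  (in `pathSpace R (pathLip ν ‖f‖₁ R)` as soon as `‖U‖ ≤ R`; realised by the constant Leray–Hopf path,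
  `steadyWeakIsGlobalLerayHopf_proof`). C: both pushforwards in `hmarg` are honest (coordinates continuous on the
  compact `pathSpace`, Fourier coefficients continuous on `H`; countable index), `energyMean ≤ R²` is bounded and
  jointly measurable, so Fubini + Parseval give `∫ energyMean dQ = ensembleEnergy μ`, and monotone convergence in `K`
  with (1.29) gives the dissipation clause — TRUE as stated for every `R`, `L`. D: TRUE as stated; note for its prover:
  `c₀` must absorb the PRE-HISTORY segment `[0, s]` of `ω` (only `pathDiss ≤ 4π²νK²R²` from `pathSpace` is available
  there, `pathDiss_le`) and `½‖u 0‖²`; on `[s, n]` use `pathDiss ν K ω (s+τ) ≤ ν (eGradNormSq (u τ)).toReal` for a.e.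
  `τ` (finite by `memL2Sobolev`), the Leray–Hopf inequality from `0`, Cauchy–Schwarz in time
  (`MomentParity.integral_sqrt_le`) and Parseval `pathEnergyTot ω (s+τ) = ‖u τ‖²`.
* No target broken; no `stub_…_false`. CERTIFIED COPY of §7–§7b proposed as
  `Theorems/EnsembleRealization/Negative/CylEnergyIneqAtoms.lean` (p159273, namespace `…Theorems.EnsembleRealization.Negative`;
  names there: `cylEnergyIneq_dirac_steady`, `cylEnergyIneq_of_isStationaryStatisticalSolution_dirac`,
  `cylEnergyIneq_mixture_steady`, `steady_of_isStationaryStatisticalSolution_dirac`, with CEI written inline). -/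

/-- `CEI ν f μ` — the cylindrically weighted energy inequalities: VERBATIM the conclusion of the registered stub
`stub_cylEnergyIneq` of line `augmented-lift` (and the hypothesis `hcei` of `stub_augmentedLift`). [folklore] -/
def CEI (ν : ℝ) (f : T3 → R3) (μ : Measure H3) : Prop :=
  ∀ (m : ℕ) (g : Fin m → UnitAddTorus (Fin 3) → EuclideanSpace ℝ (Fin 3)),
      (∀ j, Torus.IsSmooth (g j)) → (∀ j, Torus.IsDivFree (g j)) → (∀ j, Torus.HasZeroMean (g j)) →
      ∀ ψ : EuclideanSpace ℝ (Fin m) × ℝ → ℝ, ContDiff ℝ 1 ψ →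
        (∃ C : ℝ, ∀ z, |ψ z| ≤ C ∧ ‖fderiv ℝ ψ z‖ ≤ C) →
        (∀ ξ : EuclideanSpace ℝ (Fin m), Monotone fun e : ℝ => ψ (ξ, e)) →
        Integrable (fun u : Torus.energySpace (Fin 3) =>
            fderiv ℝ ψ (WithLp.toLp 2 fun j => Torus.pairing u.1 (g j), ‖u‖ ^ 2) (0, 1) *
              (ν * (Torus.eGradNormSq (u.1 : UnitAddTorus (Fin 3) → EuclideanSpace ℝ (Fin 3))).toReal -
                Torus.pairing u.1 f)) μ ∧
        Integrable (fun u : Torus.energySpace (Fin 3) =>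
            Torus.nsGeneratorPairing ν f u (fun x => ∑ j, fderiv ℝ ψ
              (WithLp.toLp 2 fun j => Torus.pairing u.1 (g j), ‖u‖ ^ 2) (EuclideanSpace.single j 1, 0) • g j x)) μ ∧
        2 * ∫ u, fderiv ℝ ψ (WithLp.toLp 2 fun j => Torus.pairing u.1 (g j), ‖u‖ ^ 2) (0, 1) *
              (ν * (Torus.eGradNormSq (u.1 : UnitAddTorus (Fin 3) → EuclideanSpace ℝ (Fin 3))).toReal -
                Torus.pairing u.1 f) ∂μ ≤
          ∫ u, Torus.nsGeneratorPairing ν f u (fun x => ∑ j, fderiv ℝ ψ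
              (WithLp.toLp 2 fun j => Torus.pairing u.1 (g j), ‖u‖ ^ 2) (EuclideanSpace.single j 1, 0) • g j x) ∂μ

/-- `∂ₑψ ≥ 0`: the energy-derivative `fderiv ψ (ξ, e) (0, 1)` of a `C¹` profile nondecreasing in the energy
variable is nonnegative (chain rule along `t ↦ (ξ, t)` and `Monotone.deriv_nonneg`). [folklore] -/
theorem fderiv_inr_nonneg_of_monotone {m : ℕ} {ψ : EuclideanSpace ℝ (Fin m) × ℝ → ℝ} (hψ : ContDiff ℝ 1 ψ)
    (hmono : ∀ ξ : EuclideanSpace ℝ (Fin m), Monotone fun e : ℝ => ψ (ξ, e))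
    (ξ : EuclideanSpace ℝ (Fin m)) (e : ℝ) :
    0 ≤ fderiv ℝ ψ (ξ, e) (0, 1) := by
  have hd : HasFDerivAt ψ (fderiv ℝ ψ (ξ, e)) (ξ, e) := ((hψ.differentiable one_ne_zero) (ξ, e)).hasFDerivAt
  have hc : HasDerivAt (fun t : ℝ => ((ξ, t) : EuclideanSpace ℝ (Fin m) × ℝ))
      ((0 : EuclideanSpace ℝ (Fin m)), (1 : ℝ)) e :=
    (hasDerivAt_const e ξ).prodMk (hasDerivAt_id e)
  have hcomp : HasDerivAt (fun t : ℝ => ψ (ξ, t)) (fderiv ℝ ψ (ξ, e) (0, 1)) e := hd.comp_hasDerivAt e hc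
  rw [← hcomp.deriv]
  exact (hmono ξ).deriv_nonneg

/-- The pointwise CEI budget at a steady atom: the right-hand integrand VANISHES at a steady weak solution `U`
(linearity of `⟨F(U), ·⟩` in the test field, `Torus.nsGeneratorPairing_sum_smul`, and `⟨F(U), gⱼ⟩ = 0`). [folklore] -/
theorem nsGeneratorPairing_sum_smul_eq_zero_of_steady {ν : ℝ} {f : T3 → R3} (hf : Torus.IsSmooth f) {U : H3}
    (hU : Torus.IsSteadyWeakSolution ν f U) {m : ℕ} (c : Fin m → ℝ)
    {g : Fin m → UnitAddTorus (Fin 3) → EuclideanSpace ℝ (Fin 3)}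
    (hg : ∀ j, Torus.IsSmooth (g j)) (hdiv : ∀ j, Torus.IsDivFree (g j)) (h0 : ∀ j, Torus.HasZeroMean (g j)) :
    Torus.nsGeneratorPairing ν f U (fun x => ∑ j, c j • g j x) = 0 := by
  rw [Torus.nsGeneratorPairing_sum_smul ν ((hf.memLp 2).integrable one_le_two) U Finset.univ c fun j _ => hg j]
  exact Finset.sum_eq_zero fun j _ => by rw [hU (g j) (hg j) (hdiv j) (h0 j), mul_zero]

/-- The pointwise CEI budget at a steady atom: the left-hand integrand is `≤ 0` at any `U` with the steady energy
inequality `ν‖U‖_V² ≤ (f, U)`, because `∂ₑψ ≥ 0`. [folklore] -/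
theorem cei_lhs_nonpos_of_energy_le {ν : ℝ} {f : T3 → R3} {U : H3}
    (hE : ν * (Torus.eGradNormSq (U.1 : T3 → R3)).toReal ≤ Torus.pairing U.1 f)
    {m : ℕ} {ψ : EuclideanSpace ℝ (Fin m) × ℝ → ℝ} (hψ : ContDiff ℝ 1 ψ)
    (hmono : ∀ ξ : EuclideanSpace ℝ (Fin m), Monotone fun e : ℝ => ψ (ξ, e)) (ξ : EuclideanSpace ℝ (Fin m)) :
    fderiv ℝ ψ (ξ, ‖U‖ ^ 2) (0, 1) * (ν * (Torus.eGradNormSq (U.1 : T3 → R3)).toReal - Torus.pairing U.1 f) ≤ 0 :=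
  mul_nonpos_of_nonneg_of_nonpos (fderiv_inr_nonneg_of_monotone hψ hmono ξ _) (sub_nonpos.2 hE)

/-- **Stub A holds on atoms** (small model; `-- Targets`): the Dirac law at a steady weak solution with the steady
energy inequality satisfies `CEI` — for every `ν`, with `LHS ≤ 0 = RHS`. In particular no Dirac Foias–Prodi measure
(`IsSteadyWeakSolution.isStationaryStatisticalSolution_dirac`) refutes `stub_cylEnergyIneq`. [folklore] -/
theorem cei_dirac_steady {ν : ℝ} {f : T3 → R3} (hf : Torus.IsSmooth f) {U : H3}
    (hU : Torus.IsSteadyWeakSolution ν f U)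
    (hE : ν * (Torus.eGradNormSq (U.1 : T3 → R3)).toReal ≤ Torus.pairing U.1 f) :
    CEI ν f (Measure.dirac U) := by
  haveI : MeasurableSingletonClass H3 := OpensMeasurableSpace.toMeasurableSingletonClass
  intro m g hg hdiv h0 ψ hψ _hC hmono
  refine ⟨Torus.integrable_dirac _ _, Torus.integrable_dirac _ _, ?_⟩
  rw [integral_dirac, integral_dirac, nsGeneratorPairing_sum_smul_eq_zero_of_steady hf hU _ hg hdiv h0]
  have h := cei_lhs_nonpos_of_energy_le hE hψ hmono (WithLp.toLp 2 fun j => Torus.pairing U.1 (g j))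
  linarith

/-- **Stub A holds on finite mixtures of steady atoms** (`μ = ∑ᵢ pᵢ δ_{Uᵢ}`, `pᵢ < ∞`, each `Uᵢ` steady with the
steady energy inequality): `LHS ≤ 0 = RHS` again. Together with "finitely supported Foias–Prodi ⇒ mixture of steady
atoms" this exhausts every explicitly constructible Foias–Prodi measure: CEI has no finite-dimensional test. [folklore] -/
theorem cei_mixture_steady {ν : ℝ} {f : T3 → R3} (hf : Torus.IsSmooth f) {ι : Type*} (s : Finset ι)
    (p : ι → ℝ≥0∞) (hp : ∀ i ∈ s, p i ≠ ∞) (U : ι → H3)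
    (hU : ∀ i ∈ s, Torus.IsSteadyWeakSolution ν f (U i))
    (hE : ∀ i ∈ s, ν * (Torus.eGradNormSq ((U i).1 : T3 → R3)).toReal ≤ Torus.pairing (U i).1 f) :
    CEI ν f (∑ i ∈ s, p i • Measure.dirac (U i)) := by
  haveI : MeasurableSingletonClass H3 := OpensMeasurableSpace.toMeasurableSingletonClass
  intro m g hg hdiv h0 ψ hψ _hC hmono
  have hint : ∀ (F : H3 → ℝ), Integrable F (∑ i ∈ s, p i • Measure.dirac (U i)) := fun F =>
    integrable_finsetSum_measure.2 fun i hi => (Torus.integrable_dirac _ _).smul_measure (hp i hi)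
  refine ⟨hint _, hint _, ?_⟩
  rw [integral_finsetSum_measure fun i hi => (Torus.integrable_dirac _ _).smul_measure (hp i hi),
    integral_finsetSum_measure fun i hi => (Torus.integrable_dirac _ _).smul_measure (hp i hi)]
  simp_rw [integral_smul_measure, integral_dirac]
  have hR : ∑ i ∈ s, (p i).toReal • Torus.nsGeneratorPairing ν f (U i) (fun x => ∑ j, fderiv ℝ ψ
      (WithLp.toLp 2 fun j => Torus.pairing (U i).1 (g j), ‖U i‖ ^ 2) (EuclideanSpace.single j 1, 0) • g j x) = 0 :=
    Finset.sum_eq_zero fun i hi => by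
      rw [nsGeneratorPairing_sum_smul_eq_zero_of_steady hf (hU i hi) _ hg hdiv h0, smul_zero]
  have hL : ∑ i ∈ s, (p i).toReal • (fderiv ℝ ψ (WithLp.toLp 2 fun j => Torus.pairing (U i).1 (g j), ‖U i‖ ^ 2) (0, 1) *
      (ν * (Torus.eGradNormSq ((U i).1 : T3 → R3)).toReal - Torus.pairing (U i).1 f)) ≤ 0 :=
    Finset.sum_nonpos fun i hi => smul_nonpos_of_nonneg_of_nonpos ENNReal.toReal_nonneg
      (cei_lhs_nonpos_of_energy_le (hE i hi) hψ hmono _)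
  rw [hR]
  linarith


/-! ### §7b The converse on atoms: a Dirac Foias–Prodi measure IS a steady atom, so EVERY Dirac FP law satisfies CEI -/

/-- A compactly supported `C¹` profile on `ℝ¹` with prescribed unit derivative at a point: `φ(x) = ⟪e₀, x − c⟫ · b(x)`
with `b` a smooth bump equal to `1` near `c`; then `φ` is `C¹`, compactly supported, and `∂₀φ(c) = 1`. [folklore] -/
theorem exists_profile_fderiv_eq_one (c : EuclideanSpace ℝ (Fin 1)) :
    ∃ φ : EuclideanSpace ℝ (Fin 1) → ℝ, ContDiff ℝ 1 φ ∧ HasCompactSupport φ ∧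
      fderiv ℝ φ c (EuclideanSpace.single 0 1) = 1 := by
  set ℓ : EuclideanSpace ℝ (Fin 1) →L[ℝ] ℝ := innerSL ℝ (EuclideanSpace.single (0 : Fin 1) (1 : ℝ)) with hℓ
  let b : ContDiffBump c := ⟨1, 2, one_pos, one_lt_two⟩
  refine ⟨fun x => ℓ (x - c) * b x, ?_, ?_, ?_⟩
  · exact (ℓ.contDiff.comp (contDiff_id.sub contDiff_const)).mul b.contDiff
  · exact b.hasCompactSupport.mul_left
  · have hlin : HasFDerivAt (fun x : EuclideanSpace ℝ (Fin 1) => ℓ (x - c)) ℓ c := by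
      have h1 : HasFDerivAt (fun x : EuclideanSpace ℝ (Fin 1) => x - c)
          (ContinuousLinearMap.id ℝ (EuclideanSpace ℝ (Fin 1))) c := (hasFDerivAt_id c).sub_const c
      have h2 := ℓ.hasFDerivAt.comp c h1
      rw [ContinuousLinearMap.comp_id] at h2
      exact h2
    have hev : (fun x => ℓ (x - c) * b x) =ᶠ[𝓝 c] fun x => ℓ (x - c) := by
      filter_upwards [b.eventuallyEq_one] with x hx
      rw [hx, Pi.one_apply, mul_one]
    rw [hev.fderiv_eq, hlin.fderiv, hℓ, innerSL_apply_apply]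
    simp

/-- **Dirac Foias–Prodi laws are steady atoms.** If `δ_U` is a Foias–Prodi stationary statistical solution of
NS_ν(f) then `U` is a steady weak solution (Liouville identity (1.30) tested on the cylindrical functional
`Φ(u) = φ((u, w))` with `∂φ = 1` at `(U, w)`, and linearity `Torus.nsGeneratorPairing_grad`), `U` has finite
enstrophy ((1.29)) and satisfies the steady energy inequality `ν‖U‖_V² ≤ (f, U)` ((1.31) on the full shell).
Converse of `IsSteadyWeakSolution.isStationaryStatisticalSolution_dirac`. [folklore] -/
theorem steady_of_isStationaryStatisticalSolution_dirac {ν : ℝ} {f : T3 → R3} (hf : Torus.IsSmooth f) {U : H3}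
    (hμ : Torus.IsStationaryStatisticalSolution ν f (Measure.dirac U)) :
    Torus.IsSteadyWeakSolution ν f U ∧ Torus.eGradNormSq (U.1 : T3 → R3) < ∞ ∧
      ν * (Torus.eGradNormSq (U.1 : T3 → R3)).toReal ≤ Torus.pairing U.1 f := by
  haveI : MeasurableSingletonClass H3 := OpensMeasurableSpace.toMeasurableSingletonClass
  refine ⟨fun w hw hdiv h0 => ?_, ?_, ?_⟩
  · -- Liouville on `Φ(u) = φ((u, w))`
    obtain ⟨φ, hφ1, hφ2, hφ3⟩ :=
      exists_profile_fderiv_eq_one (WithLp.toLp 2 fun _ : Fin 1 => Torus.pairing U.1 w)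
    let Φ : Torus.CylindricalTest (Fin 3) :=
      { m := 1, g := fun _ => w, g_smooth := fun _ => hw, g_divFree := fun _ => hdiv, g_zeroMean := fun _ => h0,
        φ := φ, φ_contDiff := hφ1, φ_compact := hφ2 }
    have hgen := (hμ.generator Φ).2
    rw [integral_dirac, Torus.nsGeneratorPairing_grad ν ((hf.memLp 2).integrable one_le_two) Φ U] at hgen
    have hcoords : Φ.coords U = WithLp.toLp 2 fun _ : Fin 1 => Torus.pairing U.1 w := rfl
    simp only [Finset.univ_unique, Fin.default_eq_zero, Finset.sum_singleton] at hgen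
    rw [hcoords, hφ3, one_mul] at hgen
    exact hgen
  · have h := hμ.enstrophy_finite
    rwa [lintegral_dirac] at h
  · have h := hμ.energy_ineq 0 ⊤ (by simp)
    classical
    rw [setIntegral_dirac] at h
    have hmem : U ∈ {u : H3 | (0 : ℝ≥0∞) ≤ ‖u‖ₑ ^ 2 ∧ ‖u‖ₑ ^ 2 < ⊤} :=
      ⟨zero_le, ENNReal.pow_lt_top enorm_lt_top⟩
    rw [if_pos hmem] at h
    exact sub_nonpos.1 h

/-- **Every Dirac Foias–Prodi law satisfies CEI** (`stub_cylEnergyIneq` restricted to atoms is a THEOREM, for every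
`ν`): combine `steady_of_isStationaryStatisticalSolution_dirac` with `cei_dirac_steady`. [folklore] -/
theorem cei_of_isStationaryStatisticalSolution_dirac {ν : ℝ} {f : T3 → R3} (hf : Torus.IsSmooth f) {U : H3}
    (hμ : Torus.IsStationaryStatisticalSolution ν f (Measure.dirac U)) : CEI ν f (Measure.dirac U) :=
  let h := steady_of_isStationaryStatisticalSolution_dirac hf hμ
  cei_dirac_steady hf h.1 h.2.2


/-! ### §7c CEI can only fail on measures CHARGING NON-STEADY STATES -/

/-- Under Foias–Prodi stationarity the pairing `u ↦ (u, f)` is integrable (`|(u,f)| ≤ ‖u‖ ‖f‖₂ ≤ ‖f‖₂ (‖u‖² + 1)`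
and `∫‖u‖² dμ < ∞`). [folklore] -/
theorem integrable_pairing_of_isStationaryStatisticalSolution {ν : ℝ} {f : T3 → R3} (hf : Torus.IsSmooth f)
    {μ : Measure H3} (hμ : Torus.IsStationaryStatisticalSolution ν f μ) :
    Integrable (fun u : H3 => Torus.pairing u.1 f) μ := by
  haveI := hμ.prob
  have hf2 := hf.memLp 2
  refine Integrable.mono'
    (((integrable_norm_sq_of_isStationaryStatisticalSolution hμ).add (integrable_const 1)).const_mul ‖hf2.toLp f‖)
    (Torus.continuous_pairing_coe hf2).aestronglyMeasurable (ae_of_all _ fun u => ?_)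
  rw [Real.norm_eq_abs]
  calc |Torus.pairing u.1 f| ≤ ‖u‖ * ‖hf2.toLp f‖ := Torus.abs_pairing_coe_le hf2 u
    _ ≤ ‖hf2.toLp f‖ * (‖u‖ ^ 2 + 1) := by
        nlinarith [norm_nonneg u, norm_nonneg (hf2.toLp f), sq_nonneg (‖u‖ - 1)]

/-- **CEI holds for every Foias–Prodi measure carried by steady states** obeying the steady energy inequality
(`μ`-a.e. `u` is a steady weak solution with `ν‖u‖_V² ≤ (f,u)`; e.g. any measure on a circle of translates of a
steady state of an `x₁`-invariant force): `LHS ≤ 0 = RHS`. So a counterexample to `stub_cylEnergyIneq` must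
CHARGE NON-STEADY STATES, i.e. carry genuinely dynamic statistics. [folklore] -/
theorem cei_of_ae_steady {ν : ℝ} {f : T3 → R3} (hf : Torus.IsSmooth f) {μ : Measure H3}
    (hμ : Torus.IsStationaryStatisticalSolution ν f μ)
    (hst : ∀ᵐ u ∂μ, Torus.IsSteadyWeakSolution ν f u ∧
      ν * (Torus.eGradNormSq (u.1 : T3 → R3)).toReal ≤ Torus.pairing u.1 f) :
    CEI ν f μ := by
  intro m g hg hdiv h0 ψ hψ hC hmono
  obtain ⟨C, hC⟩ := hC
  -- continuity of the cylindrical coordinates and of the weights `∂ψ(ξ(u), |u|²) v`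
  have hξ : Continuous fun u : H3 =>
      (WithLp.toLp 2 fun j => Torus.pairing u.1 (g j) : EuclideanSpace ℝ (Fin m)) :=
    (PiLp.continuous_toLp 2 _).comp (continuous_pi fun j => Torus.continuous_pairing_coe ((hg j).memLp 2))
  have hw : ∀ v : EuclideanSpace ℝ (Fin m) × ℝ, Continuous fun u : H3 =>
      fderiv ℝ ψ (WithLp.toLp 2 fun j => Torus.pairing u.1 (g j), ‖u‖ ^ 2) v := fun v =>
    (ContinuousLinearMap.apply ℝ ℝ v).continuous.comp
      ((hψ.continuous_fderiv one_ne_zero).comp (hξ.prodMk (continuous_norm.pow 2)))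
  have hwb : ∀ (v : EuclideanSpace ℝ (Fin m) × ℝ) (u : H3),
      ‖fderiv ℝ ψ (WithLp.toLp 2 fun j => Torus.pairing u.1 (g j), ‖u‖ ^ 2) v‖ ≤ C * ‖v‖ := fun v u =>
    (ContinuousLinearMap.le_opNorm _ _).trans (mul_le_mul_of_nonneg_right (hC _).2 (norm_nonneg _))
  -- the energy budget `G(u) = ν‖u‖_V² − (f,u)` is integrable ((1.29) and the pairing bound)
  have hG : Integrable (fun u : H3 =>
      ν * (Torus.eGradNormSq (u.1 : T3 → R3)).toReal - Torus.pairing u.1 f) μ :=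
    ((integrable_toReal_of_lintegral_ne_top Torus.measurable_eGradNormSq_coe.aemeasurable
      hμ.enstrophy_finite.ne).const_mul ν).sub (integrable_pairing_of_isStationaryStatisticalSolution hf hμ)
  -- the right-hand integrand vanishes a.e. (steadiness), the left-hand one is a.e. nonpositive
  have hR : (fun u : H3 => Torus.nsGeneratorPairing ν f u (fun x => ∑ j, fderiv ℝ ψ
      (WithLp.toLp 2 fun j => Torus.pairing u.1 (g j), ‖u‖ ^ 2) (EuclideanSpace.single j 1, 0) • g j x)) =ᵐ[μ] 0 := by
    filter_upwards [hst] with u hu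
    exact nsGeneratorPairing_sum_smul_eq_zero_of_steady hf hu.1 _ hg hdiv h0
  have hL : (fun u : H3 => fderiv ℝ ψ (WithLp.toLp 2 fun j => Torus.pairing u.1 (g j), ‖u‖ ^ 2) (0, 1) *
      (ν * (Torus.eGradNormSq (u.1 : T3 → R3)).toReal - Torus.pairing u.1 f)) ≤ᵐ[μ] 0 := by
    filter_upwards [hst] with u hu
    exact cei_lhs_nonpos_of_energy_le hu.2 hψ hmono _
  refine ⟨hG.bdd_mul (hw (0, 1)).aestronglyMeasurable (ae_of_all _ (hwb (0, 1))),
    (integrable_zero _ _ μ).congr hR.symm, ?_⟩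
  rw [integral_eq_zero_of_ae hR]
  linarith [integral_nonpos_of_ae hL]


/-! ## §8 Dirac Foias–Prodi laws CHARACTERISED; the crux is TRUE on every Dirac law (no extra hypotheses) -/

/-- **Dirac Foias–Prodi laws, characterised**: `δ_U` is a Foias–Prodi stationary statistical solution of NS_ν(f)
(`f` smooth) iff `U ∈ V` is a steady weak solution (→: `steady_of_isStationaryStatisticalSolution_dirac` and
`memSobolev_one_complexify_of_eGradNormSq_ne_top`; ←: `IsSteadyWeakSolution.isStationaryStatisticalSolution_dirac`
with Temam's energy equation `Temam1979_steadyWeakSolution_energy_eq_holds`, `card (Fin 3) ≤ 4`). [folklore] -/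
theorem isStationaryStatisticalSolution_dirac_iff {ν : ℝ} {f : T3 → R3} (hf : Torus.IsSmooth f) (U : H3) :
    Torus.IsStationaryStatisticalSolution ν f (Measure.dirac U) ↔
      Torus.IsSteadyWeakSolution ν f U ∧ U.1 ∈ Torus.energySpaceV (Fin 3) := by
  constructor
  · intro hμ
    obtain ⟨hst, hfin, _⟩ := steady_of_isStationaryStatisticalSolution_dirac hf hμ
    exact ⟨hst, U.2, Torus.memSobolev_one_complexify_of_eGradNormSq_ne_top (Lp.memLp _) hfin.ne⟩
  · rintro ⟨hU, hV⟩
    exact hU.isStationaryStatisticalSolution_dirac hV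
      (Torus.Temam1979_steadyWeakSolution_energy_eq_holds (by simp) (hf.memLp 2) hV hU).le

/-- **The crux HOLDS on every Dirac Foias–Prodi law** — with `M = E` and WITHOUT the `1/2`-loss, and with no
hypothesis beyond the crux's own (`realised_of_dirac_steady` + the characterisation + Temam's energy equation):
atoms can never refute `EnsembleRealization`. [folklore] -/
theorem ensembleRealization_dirac {f : T3 → R3} (hf : Torus.IsSmooth f) (hf0 : Torus.HasZeroMean f)
    {ν : ℝ} (hν : 0 < ν) {U : H3} (hμ : Torus.IsStationaryStatisticalSolution ν f (Measure.dirac U))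
    {E ε : ℝ} (hE : Torus.ensembleEnergy (Measure.dirac U) ≤ E)
    (hε : ε ≤ Torus.ensembleDissipation ν (Measure.dirac U)) :
    ∃ (u₀ : T3 → R3) (u : ℝ → T3 → R3), Torus.IsGlobalLerayHopf ν (fun _ => f) u₀ u ∧
      meanEnergy u ≤ E ∧ ε ≤ meanDissipation ν u := by
  obtain ⟨hU, hV⟩ := (isStationaryStatisticalSolution_dirac_iff hf U).1 hμ
  exact realised_of_dirac_steady hν hf hf0 hV hU
    (Torus.Temam1979_steadyWeakSolution_energy_eq_holds (by simp) (hf.memLp 2) hV hU) hE hε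

end Summit.AnomalousDissipation.AnomalousDissipation.Cruxes.EnsembleRealization.Disproof
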